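import Summits.QuantumFields.YangMills.Theorems.F4SubCurvatureDoorLowDegreeInvariants
import Summits.QuantumFields.YangMills.Theorems.F4SubCurvatureDoorChannelSymmetry
import Summits.QuantumFields.YangMills.Theorems.F4SubCurvatureDoorMirrorContinuation
import Literature.MathematicalPhysics.QuantumLattice.LatticeScalarField
import Mathlib
import HarnessLib

/-!
# Route `F4SubCurvatureDoor`, crux ⟨stmt-QuantumFields-23125⟩ `RationalToGeneral`: LINE g18-A v5 — the LOW-DEGREE CHANNELS of a class
# kernel vanish (`0 < L < 6`): the `A = ∅` branch of `stub_channelShellForm` / `TopChannelCone`, settled by invariant theory alone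

Owner ym-idea-3 g18's build plan for the registered stub `stub_channelShellForm` (`Cruxes/RationalToGeneral/Lines/sextic_channel_stubplans.md`
§3–§4) splits the top channel by degree: for `L ≥ 6` the Laplace–Fourier shell cone does the work, while for `0 < L < 6` «the top channel
is a `W(F₄)`-invariant harmonic of degree `L`, hence `0`, and `A = ∅` does it».  This file PROVES the second branch in the tree, for EVERY
channel of degree `1 … 5` (top or not) and WITHOUT the Laplace–Fourier measure, the budget, continuity or reflection positivity — only the
two symmetry conjuncts of the skeleton's `InClass` are used (`W(B₄)` = signed permutations, and the isometries preserving the checkerboard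
lattice `D₄`, among which the diagonal short-root reflection `x ↦ x − ½(Σₖxₖ)(1,1,1,1)`):

* § 1 `isSignedPerm_perm`, `perm_apply` — coordinate permutations as signed-permutation isometries; `exists_diag_reflection` — the
  diagonal short-root reflection is a linear isometry of `ℝ⁴` preserving `D₄` (existence form, no definition introduced);
* § 2 `channelSum_comp_eq_of_invariant`, `channel_eval_comp_eq_of_invariant` — a symmetry of the kernel is a symmetry of its harmonic
  channel expansion off the origin, hence (C2(i)) of every frozen-radius channel `y ↦ Σ_{d_k = L} g_k(r²) H_k(y)` at EVERY `y ∈ ℝ⁴`;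
* § 3 ★ `channel_smul_eq_zero_of_low_degree` / ★ `channel_eq_zero_of_low_degree` — for a kernel `K` with `K ∘ R = K` for all signed
  permutations and all `D₄`-preserving isometries, and a finite harmonic channel expansion `K(x) = Σ_k g_k(‖x‖²) H_k(x)` off `0`
  (`H_k` harmonic homogeneous of degree `d_k`): for `0 < L < 6` and every `r > 0` the frozen-radius channel polynomial
  `Σ_{d_k = L} g_k(r²)·H_k` is ZERO (C2(i) ✓`F4SubCurvatureDoorChannelSymmetry.channel_eval_comp_eq` feeds the evaluation-level
  invariances into C2′ ✓`F4SubCurvatureDoorLowDegreeInvariants.eq_zero_of_harmonic_F4_invariant_low_degree`), hence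
  `Σ_{d_k = L} g_k(‖x‖²) H_k(x) = 0` for `x ≠ 0` — literally the conclusion of the skeleton's `TopChannelCone` at these `L`;
* § 4 `radial_of_harmonicExpansion_of_degree_lt_six` — a kernel of this symmetry class whose harmonic channels all have degree `< 6`
  is radial off the origin (the invariant-theory regime of T2′ `FiniteTypeRigidity`; no positivity needed).

CONSEQUENCE for the CSF holder: in `stub_channelShellForm` / `topChannelCone_of` only top degrees `L ≥ 6` need the shell cone; for
`0 < L < 6` take `A := PEmpty` (all `A`-indexed conjuncts vacuous, (R) reads `T_L = C·0` by `channel_eq_zero_of_low_degree`).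
THEOREMS ONLY; Mathlib + tree; no `sorry`; standard axioms.  HONEST LABEL: the wall-free algebraic branch of an OPEN XL stub; the sextic
and higher channels (`L ≥ 6`), T1″ (the wall), C3, ⟨23125⟩ / ⟨23035⟩, rung R2d and the summit remain OPEN; the Yang–Mills mass gap is NOT
proved; no summit is proved by a line.  Seat `ym-line-frs-p2` g14 (free hands), `--supports stmt-QuantumFields-23125`.
[cite: AxlerBourdonRamey2001, Thm. 5.7] [folklore: harmonic `W(F₄)`-invariants have Poincaré series `1/((1−t⁶)(1−t⁸)(1−t¹²))`]
-/

set_option autoImplicit false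

noncomputable section

namespace Summit.QuantumFields.YangMills.Theorems.F4SubCurvatureDoorLowDegreeChannels

open MvPolynomial
open scoped BigOperators
open Literature.MathematicalPhysics.QuantumLattice (siteToE siteToE_apply)
open Summit.QuantumFields.YangMills.Cruxes.OSLegsAtWeakCouplingC.Sketch (IsSignedPerm)
open Summit.QuantumFields.YangMills.Theorems.F4SubCurvatureDoorGlobalReduction
  (reflection_single_apply isSignedPerm_reflection_single)
open Summit.QuantumFields.YangMills.Theorems.F4SubCurvatureDoorChannelSymmetry (channel_eval_comp_eq)
open Summit.QuantumFields.YangMills.Theorems.F4SubCurvatureDoorLowDegreeInvariants (eq_zero_of_harmonic_F4_invariant_low_degree)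

/-! ## § 1. The symmetries as linear isometries of `ℝ⁴` -/

/-- A coordinate permutation as a linear isometry: `(P_τ x)_i = x_{τ i}`. [folklore] -/
theorem perm_apply (τ : Equiv.Perm (Fin 4)) (x : EuclideanSpace ℝ (Fin 4)) (i : Fin 4) :
    (LinearIsometryEquiv.piLpCongrLeft 2 ℝ ℝ τ.symm x) i = x (τ i) := by
  rw [LinearIsometryEquiv.piLpCongrLeft_apply, Equiv.piCongrLeft'_apply, Equiv.symm_symm]

/-- Coordinate permutations are signed permutations (with all signs `+`). [folklore] -/
theorem isSignedPerm_perm (τ : Equiv.Perm (Fin 4)) : IsSignedPerm (LinearIsometryEquiv.piLpCongrLeft 2 ℝ ℝ τ.symm) := by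
  intro i
  exact ⟨τ.symm i, Or.inl (LinearIsometryEquiv.piLpCongrLeft_single (p := 2) (𝕜 := ℝ) (E := ℝ) τ.symm i 1)⟩

/-- **The diagonal short-root reflection.**  There is a linear isometry `S` of `ℝ⁴` — the reflection `x ↦ x − ½(Σₖ xₖ)(1,1,1,1)` in the
mirror orthogonal to the short root `½(1,1,1,1)` of `F₄` — which maps the checkerboard lattice `D₄ = {z ∈ ℤ⁴ : Σ zᵢ even}` into itself
(so it is one of the lattice isometries of the C3 class). Existence form; no definition is introduced. [folklore] -/
theorem exists_diag_reflection :
    ∃ S : EuclideanSpace ℝ (Fin 4) ≃ₗᵢ[ℝ] EuclideanSpace ℝ (Fin 4),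
      (∀ (x : EuclideanSpace ℝ (Fin 4)) (i : Fin 4), S x i = x i - (1 / 2) * ∑ k, x k) ∧
      (∀ z : Fin 4 → ℤ, Even (∑ i, z i) → ∃ w : Fin 4 → ℤ, Even (∑ i, w i) ∧ S (siteToE z) = siteToE w) := by
  -- the coordinate map
  let f : EuclideanSpace ℝ (Fin 4) → (Fin 4 → ℝ) := fun x i => x i - (1 / 2) * ∑ k, x k
  let L : EuclideanSpace ℝ (Fin 4) →ₗ[ℝ] EuclideanSpace ℝ (Fin 4) :=
    { toFun := fun x => WithLp.toLp 2 (f x)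
      map_add' := fun x y => by
        ext j
        simp only [f, PiLp.add_apply, Finset.sum_add_distrib]
        ring
      map_smul' := fun c x => by
        ext j
        simp only [f, PiLp.smul_apply, smul_eq_mul, RingHom.id_apply]
        rw [← Finset.mul_sum]
        ring }
  have hL : ∀ (x : EuclideanSpace ℝ (Fin 4)) (j : Fin 4), L x j = f x j := fun x j => rfl
  have hsumL : ∀ x : EuclideanSpace ℝ (Fin 4), ∑ k, L x k = -∑ k, x k := fun x => by
    simp only [hL, f, Finset.sum_sub_distrib, Finset.sum_const, Finset.card_univ, Fintype.card_fin, nsmul_eq_mul]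
    push_cast
    ring
  have hLL : ∀ x, L (L x) = x := fun x => by
    ext j
    rw [hL, show f (L x) j = L x j - (1 / 2) * ∑ k, L x k from rfl, hsumL, hL]
    simp only [f]
    ring
  let Le : EuclideanSpace ℝ (Fin 4) ≃ₗ[ℝ] EuclideanSpace ℝ (Fin 4) :=
    { L with
      invFun := L
      left_inv := hLL
      right_inv := hLL }
  have hnorm : ∀ x : EuclideanSpace ℝ (Fin 4), ‖Le x‖ = ‖x‖ := fun x => by
    show ‖L x‖ = ‖x‖
    have hsq : ‖L x‖ ^ 2 = ‖x‖ ^ 2 := by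
      rw [EuclideanSpace.real_norm_sq_eq, EuclideanSpace.real_norm_sq_eq]
      simp only [hL, f, Fin.sum_univ_four]
      ring
    exact (pow_left_inj₀ (norm_nonneg _) (norm_nonneg _) two_ne_zero).mp hsq
  let S : EuclideanSpace ℝ (Fin 4) ≃ₗᵢ[ℝ] EuclideanSpace ℝ (Fin 4) := LinearIsometryEquiv.mk Le hnorm
  have hS : ∀ (x : EuclideanSpace ℝ (Fin 4)) (j : Fin 4), S x j = f x j := fun x j => rfl
  refine ⟨S, fun x i => hS x i, ?_⟩
  -- `S` preserves `D₄`
  intro z hz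
  obtain ⟨m, hm⟩ := hz
  have hm' : ∑ k, (z k : ℝ) = m + m := by exact_mod_cast hm
  refine ⟨fun i => z i - m, ⟨-m, ?_⟩, ?_⟩
  · simp only [Finset.sum_sub_distrib, Finset.sum_const, Finset.card_univ, Fintype.card_fin]
    rw [hm]
    ring
  · ext j
    rw [hS, siteToE_apply]
    simp only [f, siteToE_apply, hm']
    push_cast
    ring

/-! ## § 2. A symmetry of the kernel is a symmetry of its channel expansion -/

/-- If `K ∘ R = K` for a linear isometry `R` and `K(x) = Σ_k g_k(‖x‖²) H_k(x)` off the origin, then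
`Σ_k g_k(‖x‖²) H_k(R x) = Σ_k g_k(‖x‖²) H_k(x)` off the origin. [folklore] -/
theorem channelSum_comp_eq_of_invariant {ι : Type*} [Fintype ι] (K : EuclideanSpace ℝ (Fin 4) → ℝ)
    (R : EuclideanSpace ℝ (Fin 4) ≃ₗᵢ[ℝ] EuclideanSpace ℝ (Fin 4)) (hinv : ∀ x, K (R x) = K x)
    (H : ι → MvPolynomial (Fin 4) ℝ) (g : ι → ℝ → ℝ)
    (hexp : ∀ x : EuclideanSpace ℝ (Fin 4), x ≠ 0 → K x = ∑ k, g k (‖x‖ ^ 2) * eval (fun i => x i) (H k))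
    (x : EuclideanSpace ℝ (Fin 4)) (hx : x ≠ 0) :
    ∑ k, g k (‖x‖ ^ 2) * eval (fun i => (R x) i) (H k) = ∑ k, g k (‖x‖ ^ 2) * eval (fun i => x i) (H k) := by
  have hRx : R x ≠ 0 := fun h0 => hx (by
    have hn : ‖R x‖ = 0 := by rw [h0, norm_zero]
    rw [LinearIsometryEquiv.norm_map] at hn
    exact norm_eq_zero.mp hn)
  have h := hexp (R x) hRx
  rw [LinearIsometryEquiv.norm_map, hinv x, hexp x hx] at h
  exact h.symm

/-- **Every symmetry of the kernel is a symmetry of each frozen-radius channel** (C2(i) ✓`channel_eval_comp_eq` fed by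
`channelSum_comp_eq_of_invariant`): if `K ∘ R = K` then for every degree `L`, radius `r > 0` and every `y ∈ ℝ⁴`,
`Σ_{d_k = L} g_k(r²) H_k(R y) = Σ_{d_k = L} g_k(r²) H_k(y)`. [cite: AxlerBourdonRamey2001, Thm. 5.7] -/
theorem channel_eval_comp_eq_of_invariant {ι : Type*} [Fintype ι] (K : EuclideanSpace ℝ (Fin 4) → ℝ)
    (R : EuclideanSpace ℝ (Fin 4) ≃ₗᵢ[ℝ] EuclideanSpace ℝ (Fin 4)) (hinv : ∀ x, K (R x) = K x)
    (H : ι → MvPolynomial (Fin 4) ℝ) (d : ι → ℕ) (g : ι → ℝ → ℝ)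
    (hH : ∀ k, (H k).IsHomogeneous (d k)) (hharm : ∀ k, ∑ i, pderiv i (pderiv i (H k)) = 0)
    (hexp : ∀ x : EuclideanSpace ℝ (Fin 4), x ≠ 0 → K x = ∑ k, g k (‖x‖ ^ 2) * eval (fun i => x i) (H k))
    (L : ℕ) {r : ℝ} (hr : 0 < r) (y : EuclideanSpace ℝ (Fin 4)) :
    ∑ k ∈ Finset.univ.filter (fun k => d k = L), g k (r ^ 2) * eval (fun i => (R y) i) (H k) =
      ∑ k ∈ Finset.univ.filter (fun k => d k = L), g k (r ^ 2) * eval (fun i => y i) (H k) :=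
  channel_eval_comp_eq H d g hH hharm R (channelSum_comp_eq_of_invariant K R hinv H g hexp) L hr y

/-! ## § 3. The channels of degree `1 … 5` vanish -/

section Main

variable {ι : Type*} [Fintype ι] {K : EuclideanSpace ℝ (Fin 4) → ℝ}
  {H : ι → MvPolynomial (Fin 4) ℝ} {d : ι → ℕ} {g : ι → ℝ → ℝ}

/-- ★ **The frozen-radius channel polynomial of degree `L ∈ {1,…,5}` is zero.**  For a kernel `K : ℝ⁴ → ℝ` invariant under the signed
permutations of the axes and under the isometries preserving `D₄`, with a finite harmonic channel expansion `K(x) = Σ_k g_k(‖x‖²) H_k(x)`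
off the origin (`H_k` harmonic, homogeneous of degree `d_k`): for `0 < L < 6` and every radius `r > 0`,
`Σ_{d_k = L} g_k(r²) · H_k = 0` as a polynomial.  (C2(i): every kernel symmetry is a symmetry of each frozen-radius channel; C2′: a
harmonic homogeneous polynomial of degree `1…5` invariant under sign flips, permutations and the diagonal reflection is `0`.)
[cite: AxlerBourdonRamey2001, Thm. 5.7] -/
theorem channel_smul_eq_zero_of_low_degree
    (hB : ∀ R : EuclideanSpace ℝ (Fin 4) ≃ₗᵢ[ℝ] EuclideanSpace ℝ (Fin 4), IsSignedPerm R → ∀ x, K (R x) = K x)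
    (hlat : ∀ R : EuclideanSpace ℝ (Fin 4) ≃ₗᵢ[ℝ] EuclideanSpace ℝ (Fin 4),
      (∀ z : Fin 4 → ℤ, Even (∑ i, z i) → ∃ w : Fin 4 → ℤ, Even (∑ i, w i) ∧ R (siteToE z) = siteToE w) →
      ∀ x, K (R x) = K x)
    (hH : ∀ k, (H k).IsHomogeneous (d k)) (hharm : ∀ k, ∑ i, pderiv i (pderiv i (H k)) = 0)
    (hexp : ∀ x : EuclideanSpace ℝ (Fin 4), x ≠ 0 → K x = ∑ k, g k (‖x‖ ^ 2) * eval (fun i => x i) (H k))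
    {L : ℕ} (hL0 : 0 < L) (hL6 : L < 6) {r : ℝ} (hr : 0 < r) :
    ∑ k ∈ Finset.univ.filter (fun k => d k = L), g k (r ^ 2) • H k = 0 := by
  classical
  set P : MvPolynomial (Fin 4) ℝ := ∑ k ∈ Finset.univ.filter (fun k => d k = L), g k (r ^ 2) • H k with hP
  -- `P` is homogeneous of degree `L` and harmonic
  have hhomP : P.IsHomogeneous L := by
    refine IsHomogeneous.sum _ _ _ fun k hk => ?_
    rw [Finset.mem_filter] at hk
    rw [smul_eq_C_mul]
    simpa [hk.2] using (isHomogeneous_C (Fin 4) (g k (r ^ 2))).mul (hH k)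
  have hharmP : ∑ i, pderiv i (pderiv i P) = 0 := by
    have h1 : ∀ i, pderiv i (pderiv i P) =
        ∑ k ∈ Finset.univ.filter (fun k => d k = L), g k (r ^ 2) • pderiv i (pderiv i (H k)) := by
      intro i
      simp only [hP, map_sum, Derivation.map_smul]
    simp_rw [h1]
    rw [Finset.sum_comm]
    refine Finset.sum_eq_zero fun k _ => ?_
    rw [← Finset.smul_sum, hharm k, smul_zero]
  -- evaluation of `P` at a point of `ℝ⁴`
  have hevalP : ∀ y : Fin 4 → ℝ, eval y P = ∑ k ∈ Finset.univ.filter (fun k => d k = L), g k (r ^ 2) * eval y (H k) := by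
    intro y
    simp only [hP, map_sum, smul_eval]
  -- every kernel symmetry `R` is a symmetry of `P` (C2(i))
  have hsymP : ∀ R : EuclideanSpace ℝ (Fin 4) ≃ₗᵢ[ℝ] EuclideanSpace ℝ (Fin 4), (∀ x, K (R x) = K x) →
      ∀ y : Fin 4 → ℝ, eval (fun j => (R (WithLp.toLp 2 y)) j) P = eval y P := by
    intro R hinv y
    have h := channel_eval_comp_eq H d g hH hharm R (channelSum_comp_eq_of_invariant K R hinv H g hexp) L hr
      (WithLp.toLp 2 y)
    rw [hevalP, hevalP]
    simpa using h
  -- the three families of symmetries, at the level of evaluations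
  have hsign : ∀ i : Fin 4, ∀ y : Fin 4 → ℝ, eval (fun j => (if j = i then (-1 : ℝ) else 1) * y j) P = eval y P := by
    intro i y
    have h := hsymP _ (hB _ (isSignedPerm_reflection_single i)) y
    have e : (fun j => ((ℝ ∙ (EuclideanSpace.single i (1 : ℝ) : EuclideanSpace ℝ (Fin 4)))ᗮ.reflection (WithLp.toLp 2 y)) j)
        = fun j => (if j = i then (-1 : ℝ) else 1) * y j := by
      funext j
      rw [reflection_single_apply]
      by_cases hj : j = i
      · simp [hj]
      · simp [hj]
    rw [e] at h
    exact h
  have hperm : ∀ τ : Equiv.Perm (Fin 4), ∀ y : Fin 4 → ℝ, eval (y ∘ τ) P = eval y P := by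
    intro τ y
    have h := hsymP _ (hB _ (isSignedPerm_perm τ)) y
    have e : (fun j => (LinearIsometryEquiv.piLpCongrLeft 2 ℝ ℝ τ.symm (WithLp.toLp 2 y)) j) = y ∘ τ := by
      funext j
      rw [perm_apply]
      rfl
    rw [e] at h
    exact h
  have hHad : ∀ y : Fin 4 → ℝ, eval (fun j => y j - (1 / 2) * ∑ k, y k) P = eval y P := by
    intro y
    obtain ⟨S, hS, hSlat⟩ := exists_diag_reflection
    have h := hsymP S (hlat S hSlat) y
    have e : (fun j => (S (WithLp.toLp 2 y)) j) = fun j => y j - (1 / 2) * ∑ k, y k := by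
      funext j
      rw [hS]
    rw [e] at h
    exact h
  exact eq_zero_of_harmonic_F4_invariant_low_degree hL0 hL6 hhomP hharmP hsign hperm hHad

/-- ★ **The channels of degree `1 … 5` of a class kernel vanish off the origin** — literally the conclusion of the skeleton's
`TopChannelCone` for `0 < L < 6`, for every such channel (top or not), without the Laplace–Fourier measure, the budget, continuity or
reflection positivity. [cite: AxlerBourdonRamey2001, Thm. 5.7] -/
theorem channel_eq_zero_of_low_degree
    (hB : ∀ R : EuclideanSpace ℝ (Fin 4) ≃ₗᵢ[ℝ] EuclideanSpace ℝ (Fin 4), IsSignedPerm R → ∀ x, K (R x) = K x)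
    (hlat : ∀ R : EuclideanSpace ℝ (Fin 4) ≃ₗᵢ[ℝ] EuclideanSpace ℝ (Fin 4),
      (∀ z : Fin 4 → ℤ, Even (∑ i, z i) → ∃ w : Fin 4 → ℤ, Even (∑ i, w i) ∧ R (siteToE z) = siteToE w) →
      ∀ x, K (R x) = K x)
    (hH : ∀ k, (H k).IsHomogeneous (d k)) (hharm : ∀ k, ∑ i, pderiv i (pderiv i (H k)) = 0)
    (hexp : ∀ x : EuclideanSpace ℝ (Fin 4), x ≠ 0 → K x = ∑ k, g k (‖x‖ ^ 2) * eval (fun i => x i) (H k))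
    {L : ℕ} (hL0 : 0 < L) (hL6 : L < 6) (x : EuclideanSpace ℝ (Fin 4)) (hx : x ≠ 0) :
    ∑ k ∈ Finset.univ.filter (fun k => d k = L), g k (‖x‖ ^ 2) * eval (fun i => x i) (H k) = 0 := by
  classical
  have h := congrArg (eval (fun i => x i))
    (channel_smul_eq_zero_of_low_degree hB hlat hH hharm hexp hL0 hL6 (norm_pos_iff.mpr hx))
  simpa only [map_sum, smul_eval, map_zero] using h

/-! ## § 4. Only channels of degree `< 6`: the kernel is radial (invariant-theory regime of T2′) -/

/-- **Radiality when all channels have degree `< 6`.**  A kernel of the symmetry class whose finite harmonic channel expansion has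
only channels of degree `< 6` is a radial function off the origin: the channels of degree `1…5` vanish and the degree-`0` harmonics are
constants.  (This is T2′ `FiniteTypeRigidity` in the regime where no positivity is needed; the sextic channel is the first that requires
the Laplace–Fourier shell cone.) [cite: AxlerBourdonRamey2001, Thm. 5.7] -/
theorem radial_of_harmonicExpansion_of_degree_lt_six
    (hB : ∀ R : EuclideanSpace ℝ (Fin 4) ≃ₗᵢ[ℝ] EuclideanSpace ℝ (Fin 4), IsSignedPerm R → ∀ x, K (R x) = K x)
    (hlat : ∀ R : EuclideanSpace ℝ (Fin 4) ≃ₗᵢ[ℝ] EuclideanSpace ℝ (Fin 4),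
      (∀ z : Fin 4 → ℤ, Even (∑ i, z i) → ∃ w : Fin 4 → ℤ, Even (∑ i, w i) ∧ R (siteToE z) = siteToE w) →
      ∀ x, K (R x) = K x)
    (hH : ∀ k, (H k).IsHomogeneous (d k)) (hharm : ∀ k, ∑ i, pderiv i (pderiv i (H k)) = 0)
    (hexp : ∀ x : EuclideanSpace ℝ (Fin 4), x ≠ 0 → K x = ∑ k, g k (‖x‖ ^ 2) * eval (fun i => x i) (H k))
    (hdeg : ∀ k, d k < 6) :
    ∃ g₀ : ℝ → ℝ, ∀ x : EuclideanSpace ℝ (Fin 4), x ≠ 0 → K x = g₀ (‖x‖ ^ 2) := by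
  classical
  refine ⟨fun s => ∑ k ∈ Finset.univ.filter (fun k => d k = 0), g k s * coeff 0 (H k), fun x hx => ?_⟩
  rw [hexp x hx, ← Finset.sum_filter_add_sum_filter_not Finset.univ (fun k => d k = 0)]
  -- the degree-0 channels are constants
  have h0 : ∑ k ∈ Finset.univ.filter (fun k => d k = 0), g k (‖x‖ ^ 2) * eval (fun i => x i) (H k)
      = ∑ k ∈ Finset.univ.filter (fun k => d k = 0), g k (‖x‖ ^ 2) * coeff 0 (H k) := by
    refine Finset.sum_congr rfl fun k hk => ?_
    rw [Finset.mem_filter] at hk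
    have hC : H k = C (coeff 0 (H k)) :=
      totalDegree_eq_zero_iff_eq_C.mp ((totalDegree_zero_iff_isHomogeneous (Fin 4)).mpr (by simpa [hk.2] using hH k))
    conv_lhs => rw [hC, eval_C]
  -- the channels of degree `1 … 5` vanish
  have hpos : ∑ k ∈ Finset.univ.filter (fun k => ¬ d k = 0), g k (‖x‖ ^ 2) * eval (fun i => x i) (H k) = 0 := by
    have hfib := Finset.sum_fiberwise_eq_sum_filter Finset.univ (Finset.Ioo 0 6) d
      (fun k => g k (‖x‖ ^ 2) * eval (fun i => x i) (H k))
    have hset : Finset.univ.filter (fun k => d k ∈ Finset.Ioo 0 6) = Finset.univ.filter (fun k => ¬ d k = 0) := by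
      refine Finset.filter_congr fun k _ => ?_
      rw [Finset.mem_Ioo]
      have := hdeg k
      omega
    rw [hset] at hfib
    rw [← hfib]
    refine Finset.sum_eq_zero fun j hj => ?_
    rw [Finset.mem_Ioo] at hj
    exact channel_eq_zero_of_low_degree hB hlat hH hharm hexp hj.1 hj.2 x hx
  rw [h0, hpos, add_zero]

end Main

/-! ## Audit: this file uses exactly the two symmetry conjuncts of `InClass`, nothing else -/

/-- For the record: the conclusion of § 3 needs neither continuity, nor the bound outside the unit ball, nor reflection positivity,
nor the sub-curvature budget — a kernel with the two symmetries and a channel expansion of degrees `< 6` is radial, whatever its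
radial profiles. [folklore] -/
theorem isometry_invariant_of_degree_lt_six {ι : Type*} [Fintype ι] (K : EuclideanSpace ℝ (Fin 4) → ℝ)
    (hB : ∀ R : EuclideanSpace ℝ (Fin 4) ≃ₗᵢ[ℝ] EuclideanSpace ℝ (Fin 4), IsSignedPerm R → ∀ x, K (R x) = K x)
    (hlat : ∀ R : EuclideanSpace ℝ (Fin 4) ≃ₗᵢ[ℝ] EuclideanSpace ℝ (Fin 4),
      (∀ z : Fin 4 → ℤ, Even (∑ i, z i) → ∃ w : Fin 4 → ℤ, Even (∑ i, w i) ∧ R (siteToE z) = siteToE w) →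
      ∀ x, K (R x) = K x)
    (H : ι → MvPolynomial (Fin 4) ℝ) (d : ι → ℕ) (g : ι → ℝ → ℝ)
    (hH : ∀ k, (H k).IsHomogeneous (d k)) (hharm : ∀ k, ∑ i, pderiv i (pderiv i (H k)) = 0)
    (hexp : ∀ x : EuclideanSpace ℝ (Fin 4), x ≠ 0 → K x = ∑ k, g k (‖x‖ ^ 2) * eval (fun i => x i) (H k))
    (hdeg : ∀ k, d k < 6) (R : EuclideanSpace ℝ (Fin 4) ≃ₗᵢ[ℝ] EuclideanSpace ℝ (Fin 4))
    (x : EuclideanSpace ℝ (Fin 4)) : K (R x) = K x := by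
  obtain ⟨g₀, hg₀⟩ := radial_of_harmonicExpansion_of_degree_lt_six hB hlat hH hharm hexp hdeg
  by_cases hx : x = 0
  · subst hx; simp
  · have hRx : R x ≠ 0 := fun h0 => hx (by
      have hn : ‖R x‖ = 0 := by rw [h0, norm_zero]
      rw [LinearIsometryEquiv.norm_map] at hn
      exact norm_eq_zero.mp hn)
    rw [hg₀ (R x) hRx, hg₀ x hx, LinearIsometryEquiv.norm_map]

end Summit.QuantumFields.YangMills.Theorems.F4SubCurvatureDoorLowDegreeChannels

end
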